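import Mathlib
import Summits.Ventures.PercRepro2.CoinChainReduction
import Summits.Ventures.PercRepro2.CoinChainHeadHyps
import Summits.Ventures.PercRepro2.CoinK2HeadBlindArcs
import Summits.Ventures.PercRepro2.CoinTreeCore
import Summits.Ventures.PercRepro2.CoinChainBlindGenDarc
import Summits.Ventures.PercRepro2.CoinChainOneAware

/-!
# Row 2′DARC at the pure AND-switch chain with ONE head-aware non-entry and entry markers
(blind cell PercRepro2, night-2 g20; proofs/NIGHT2-DARC.md §60.11)

`darc_of_pureChain_of_oneAware`: the pure chain (`a'` entered from `ent' ⊆ U` surely, `a` from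
`a'` by one coin, lsm cluster law) satisfies row 2′DARC at `a → w` for markers `m₁, m₂ ∈ ent'`
whenever every core vertex other than the entries and ONE distinguished vertex `z` has all its
out-arcs inside the core `U ∪ {a', a}` — `z` itself may have any routes into the head.
`darc_of_pureChainTree_of_oneAware` for an out-tree core.
-/

namespace Summit.Ventures.PercRepro2.Coin

open Classical

section ChainOneAwareDarc

variable {V : Type*} {E : Type*} [Fintype V] [DecidableEq V] [Fintype E] [DecidableEq E]
  {R : Type*} [Field R] [LinearOrder R] [IsStrictOrderedRing R]
  {arcs : E → Finset (V × V)} {s : V} {U : Finset V} {ent' : Finset V} {c' : V → E} {a' a w : V}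
  {c : V → E}

omit [Fintype V] [Fintype E] [DecidableEq E] [Field R] [LinearOrder R] [IsStrictOrderedRing R] in
/-- **Head-blindness of the chain data to the non-entries other than `z`.** -/
lemma chain_avoid_blindZ {t z : V} (htC : t ∉ insert a (insert a' U)) (ha'U : a' ∉ U)
    (hout : ∀ v ∈ U, v ∉ insert z ent' → ∀ e, ∀ xy ∈ arcs e, xy.1 = v → xy.2 ∈ insert a (insert a' U))
    {W : Finset V} (hW : W ⊆ U) (X : Finset V) :
    coreAvoidEvent arcs s t (insert a (insert a' U)) (chainPhi ent' a' W ∪ X) =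
      coreAvoidEvent arcs s t (insert a (insert a' U)) (chainPhi ent' a' (W ∩ insert z ent') ∪ X) := by
  have hout' : ∀ v ∈ insert a' U, v ∉ insert a' (insert z ent') →
      ∀ e, ∀ xy ∈ arcs e, xy.1 = v → xy.2 ∈ insert a (insert a' U) := by
    intro v hv hve
    rw [Finset.mem_insert] at hv hve
    have hve' := not_or.1 hve
    rcases hv with rfl | hvU
    · exact absurd rfl hve'.1
    · exact hout v hvU hve'.2
  rw [coreAvoidEvent_blind (U := insert a' U) (ent := insert a' (insert z ent')) (a := a) htC hout'
    (chainPhi_subset_insert hW) X,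
    chainPhi_inter_entriesG (Finset.subset_insert z ent') ha'U hW]

/-- **ROW 2′DARC AT THE PURE CHAIN WITH ONE HEAD-AWARE NON-ENTRY AND ENTRY MARKERS.** -/
theorem darc_of_pureChain_of_oneAware (pr : E → R) (hp : IsProbVec pr) (hS : SameEnds arcs)
    (h' : OrTailK arcs s U ent' c' a') (hsure' : ∀ r ∈ ent', pr (c' r) = 1)
    (h : OrTailK arcs s (insert a' U) {a'} c a)
    {m₁ m₂ : V} (hm₁ : m₁ ∈ ent') (hm₂ : m₂ ∈ ent')
    (hν : ∀ W W', W ⊆ U → W' ⊆ U →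
      prob pr (coreLevel arcs s U W) * prob pr (coreLevel arcs s U W') ≤
        prob pr (coreLevel arcs s U (W ∩ W')) * prob pr (coreLevel arcs s U (W ∪ W')))
    {t : V} (htC : t ∉ insert a (insert a' U)) (hts : t ≠ s) (hws : w ≠ s)
    (hwC : w ∉ insert a (insert a' U)) (z : V)
    (hout : ∀ v ∈ U, v ∉ insert z ent' → ∀ e, ∀ xy ∈ arcs e, xy.1 = v → xy.2 ∈ insert a (insert a' U)) :
    DARC pr arcs s {t} m₁ m₂ a w := by
  obtain ⟨hA0, hAmono, hAlsm⟩ := OrTailU.head_props (U := insert a' U) (a := a) pr hp hS t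
  obtain ⟨hdc, hd'd, hcc, hdd, hd'd', hdd', hratio, hratio', -, hcd, hcd'⟩ :=
    chainPhi_head_hyps (fun X => prob pr (coreAvoidEvent arcs s t (insert a (insert a' U)) X))
      ent' a' a w hA0 hAmono hAlsm
  have ha'U : a' ∉ U := h'.a_notin
  have hm₁U : m₁ ∈ U := h'.ent_sub hm₁
  have hm₂U : m₂ ∈ U := h'.ent_sub hm₂
  refine pureChain_darc_of_functional pr hS h' hsure' h hm₁U hm₂U htC hts hws hwC ?_
  set cC := chainC pr arcs s t U ent' a' a with hcC
  set cD := chainD pr arcs s t U ent' a' a with hcD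
  set cD' := chainD' pr arcs s t U ent' a' a w with hcD'
  set ν : Finset V → R := fun W => prob pr (coreLevel arcs s U W) with hνdef
  set ct : Finset V → R := fun W => cC (W ∩ U) with hct
  set dt : Finset V → R := fun W => cD (W ∩ U) with hdt
  set dt' : Finset V → R := fun W => cD' (W ∩ U) with hdt'
  have hbC : ∀ W ⊆ U, cC W = cC (W ∩ insert z ent') := fun W hW => by
    simp only [hcC, chainC]
    have := chain_avoid_blindZ (s := s) htC ha'U hout hW ∅
    rw [Finset.union_empty, Finset.union_empty] at this
    rw [this]
  have hbD : ∀ W ⊆ U, cD W = cD (W ∩ insert z ent') := fun W hW => by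
    simp only [hcD, chainD]
    rw [chain_avoid_blindZ (s := s) htC ha'U hout hW {a}]
  have hbD' : ∀ W ⊆ U, cD' W = cD' (W ∩ insert z ent') := fun W hW => by
    simp only [hcD', chainD']
    rw [chain_avoid_blindZ (s := s) htC ha'U hout hW {a, w}]
  have hres : ∀ (f : Finset V → R), (∀ W ⊆ U, f W = f (W ∩ insert z ent')) →
      ∀ W, f (W ∩ U) = f ((W ∩ insert z ent') ∩ U) := fun f hf W => by
    rw [hf (W ∩ U) Finset.inter_subset_right, Finset.inter_right_comm]
  have hrr : ∀ (f g : Finset V → R), (∀ s' t', s' ⊆ t' → f s' * g t' ≤ g s' * f t') →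
      ∀ s' t', s' ⊆ t' → f (s' ∩ U) * g (t' ∩ U) ≤ g (s' ∩ U) * f (t' ∩ U) :=
    fun f g hfg s' t' hst => hfg _ _ (Finset.inter_subset_inter hst (Finset.Subset.refl _))
  have key := pureChain_functional_nonneg_of_oneAware U ent' z a' ha'U ν ct dt dt' (pr (c a'))
    (hp.nonneg _) (hp.le_one _) (fun W => prob_nonneg hp _)
    (fun s' hs' t' ht' => hν s' t' hs' ht')
    (fun W => hA0 _) (fun W => hA0 _) (fun W => hA0 _)
    (fun W => hdc _) (fun W => hd'd _)
    (fun s' t' => by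
      show cC (s' ∩ U) * cC (t' ∩ U) ≤ cC ((s' ∩ t') ∩ U) * cC ((s' ∪ t') ∩ U)
      rw [state_inter, state_union]; exact hcc _ _)
    (fun s' t' => by
      show cD (s' ∩ U) * cD (t' ∩ U) ≤ cD ((s' ∩ t') ∩ U) * cD ((s' ∪ t') ∩ U)
      rw [state_inter, state_union]; exact hdd _ _)
    (fun s' t' => by
      show cD' (s' ∩ U) * cD' (t' ∩ U) ≤ cD' ((s' ∩ t') ∩ U) * cD' ((s' ∪ t') ∩ U)
      rw [state_inter, state_union]; exact hd'd' _ _)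
    (fun s' t' => by
      show cD (s' ∩ U) * cD' (t' ∩ U) ≤ cD ((s' ∩ t') ∩ U) * cD' ((s' ∪ t') ∩ U)
      rw [state_inter, state_union]; exact hdd' _ _)
    (fun s' t' => by
      show cC (s' ∩ U) * cD (t' ∩ U) ≤ cC ((s' ∩ t') ∩ U) * cD ((s' ∪ t') ∩ U)
      rw [state_inter, state_union]; exact hcd _ _)
    (fun s' t' => by
      show cC (s' ∩ U) * cD' (t' ∩ U) ≤ cC ((s' ∩ t') ∩ U) * cD' ((s' ∪ t') ∩ U)
      rw [state_inter, state_union]; exact hcd' _ _)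
    (hrr cD cC hratio) (hrr cD' cC hratio')
    (hres cC hbC) (hres cD hbD) (hres cD' hbD')
    (fun W => if m₁ ∈ W then (1 : R) else 0) (fun W => if m₂ ∈ W then (1 : R) else 0)
    (fun W => by split_ifs <;> norm_num) (fun W => by split_ifs <;> norm_num)
    (fun s' t' => by
      by_cases hm : m₁ ∈ s'
      · rw [if_pos hm, if_pos (Finset.mem_union_left _ hm)]
      · rw [if_neg hm]; split_ifs <;> norm_num)
    (fun s' t' => by
      by_cases hm : m₂ ∈ s'
      · rw [if_pos hm, if_pos (Finset.mem_union_left _ hm)]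
      · rw [if_neg hm]; split_ifs <;> norm_num)
    (fun W hW => by
      rw [if_neg (fun h => hW ⟨m₁, hm₁, h⟩)])
    (fun W hW => by
      rw [if_neg (fun h => hW ⟨m₂, hm₂, h⟩)])
  have hmixR : ∀ W ∈ U.powerset, chainMix ∅ ent' (pr (c a')) ct dt W =
      chainMix ∅ ent' (pr (c a')) cC cD W := fun W hW => by
    rw [Finset.mem_powerset] at hW
    simp only [chainMix, hct, hdt, Finset.inter_eq_left.mpr hW]
  have hmixG : ∀ W ∈ U.powerset, chainMix ∅ ent' (pr (c a')) ct dt' W =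
      chainMix ∅ ent' (pr (c a')) cC cD' W := fun W hW => by
    rw [Finset.mem_powerset] at hW
    simp only [chainMix, hct, hdt', Finset.inter_eq_left.mpr hW]
  have e1 : ∑ W ∈ U.powerset, ν W * chainMix ∅ ent' (pr (c a')) ct dt W =
      ∑ W ∈ U.powerset, ν W * chainMix ∅ ent' (pr (c a')) cC cD W :=
    Finset.sum_congr rfl fun W hW => by rw [hmixR W hW]
  have e2 : ∀ (J : Finset V → R), ∑ W ∈ U.powerset, ν W * chainMix ∅ ent' (pr (c a')) ct dt W * J W =
      ∑ W ∈ U.powerset, ν W * chainMix ∅ ent' (pr (c a')) cC cD W * J W := fun J =>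
    Finset.sum_congr rfl fun W hW => by rw [hmixR W hW]
  have e3 : ∑ W ∈ U.powerset, ν W * chainMix ∅ ent' (pr (c a')) ct dt' W =
      ∑ W ∈ U.powerset, ν W * chainMix ∅ ent' (pr (c a')) cC cD' W :=
    Finset.sum_congr rfl fun W hW => by rw [hmixG W hW]
  have e4 : ∀ (J : Finset V → R), ∑ W ∈ U.powerset, ν W * chainMix ∅ ent' (pr (c a')) ct dt' W * J W =
      ∑ W ∈ U.powerset, ν W * chainMix ∅ ent' (pr (c a')) cC cD' W * J W := fun J =>
    Finset.sum_congr rfl fun W hW => by rw [hmixG W hW]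
  rw [e1, e2, e2, e3, e4, e4, e4] at key
  exact key

/-- The out-tree form. -/
theorem darc_of_pureChainTree_of_oneAware (pr : E → R) (hp : IsProbVec pr) (hS : SameEnds arcs)
    (h' : OrTailK arcs s U ent' c' a') (hsure' : ∀ r ∈ ent', pr (c' r) = 1)
    (h : OrTailK arcs s (insert a' U) {a'} c a)
    {cT : V → E} {par : V → V} {rk : V → ℕ} (hT : TreeCore arcs s U cT par rk)
    {m₁ m₂ : V} (hm₁ : m₁ ∈ ent') (hm₂ : m₂ ∈ ent')
    {t : V} (htC : t ∉ insert a (insert a' U)) (hts : t ≠ s) (hws : w ≠ s)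
    (hwC : w ∉ insert a (insert a' U)) (z : V)
    (hout : ∀ v ∈ U, v ∉ insert z ent' → ∀ e, ∀ xy ∈ arcs e, xy.1 = v → xy.2 ∈ insert a (insert a' U)) :
    DARC pr arcs s {t} m₁ m₂ a w :=
  darc_of_pureChain_of_oneAware pr hp hS h' hsure' h hm₁ hm₂ (hT.coreLevel_lsm pr hp) htC hts hws
    hwC z hout

end ChainOneAwareDarc

end Summit.Ventures.PercRepro2.Coin
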